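import Summits.Ventures.PercRepro.S2ThirteenSixCell
import Summits.Ventures.PercRepro.S2ThirteenSevenUncond
import Summits.Ventures.PercRepro.S2ThirteenEightUncond
import Summits.Ventures.PercRepro.S2ThirteenNineUncond
import Summits.Ventures.PercRepro.S2ThirteenTenUncond
import Summits.Ventures.PercRepro.S2LPCoreP13D11
import Summits.Ventures.PercRepro.S2LPCoreP13D12
import Summits.Ventures.PercRepro.S2LPCoreP13D13
import Summits.Ventures.PercRepro.S2LPCoreP13D14
import Summits.Ventures.PercRepro.S2LPCoreP13D15
import Summits.Ventures.PercRepro.S2LPCoreP13D16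
import Summits.Ventures.PercRepro.S2LPCoreP13D17
import Summits.Ventures.PercRepro.S2LPCoreP13D18
import Summits.Ventures.PercRepro.S2LPCoreP13D19
import Summits.Ventures.PercRepro.S2LPCoreP13D20
import Summits.Ventures.PercRepro.S2ThirteenKeyCellsA
import Summits.Ventures.PercRepro.S2ThirteenKeyCellsB
import Summits.Ventures.PercRepro.S2CoreThirteen
import Summits.Ventures.PercRepro.S2FourteenSix
import Summits.Ventures.PercRepro.S2FourteenEight
import Summits.Ventures.PercRepro.S2FourteenNine
import Summits.Ventures.PercRepro.S2FourteenTenG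
import Summits.Ventures.PercRepro.S2FourteenEleven
import Summits.Ventures.PercRepro.RankLevelSetLevelFiveCqFifteen
import Summits.Ventures.PercRepro.RankLevelSetLevelFiveCqFifteenModulo
import Summits.Ventures.PercRepro.RankLevelSetLevelFiveCqFifteenSix

/-!
# PercRepro — S2: THEOREM C₅ AT `14` MODULO THE TEN CELLS `(13, 21 … 30)` OF THE `p = 13` ROW (p7, gen 20; sub-claim S2)

The `p = 13` row of the `e`-free core, cell by cell: `d = 6 … 10` by p7's lever cells (`c025_core_five_thirteen_{six, …, ten}`),
`d = 11 … 20` by p2's LP-certificate cells (`S2LP.c025_core_five_thirteen_{eleven, …, twenty}`), `d = 31 … 49` by the plain key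
cells (`c025_thirteen_key_31 … _49`), `d ≥ 50` by the big core (`c025_core_five_at_thirteen_big`); the cells `(13, 21 … 30)` are the
hypothesis `hten`. The `p = 14` row is complete in the tree (`c025_core_five_fourteen_{six, …, eleven}`, `c025_core_five_fourteen_xx`
for `12 ≤ d ≤ 18`, `c025_core_five_fourteen_ge_nineteen`): **`c025_core_five_fourteen_all`**. With level `4` at every `p ≥ 11`
(`S1.c025_four_eleven`), the kit's reduction `S2.rls_five_of_four_of_core 13` and Theorem C₅ at `15` (`c025_five_large_sharp15`):
**`c025_five_large_sharp14_of_ten_cells (hten) (M) (p) (hp : 14 ≤ p) : RLS M p 5`** — C-025 at level `5` for every `p ≥ 14` MODULO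
the ten cells `(13, 21 … 30)` (their LP-certificate modules are filing). The window is NOT moved by this file. Axioms: standard.
-/

open scoped Matroid

namespace PercRepro

namespace ThmN

variable {α : Type}

/-- The landed cells of the `p = 13` row, `6 ≤ d ≤ 20`, dispatched by `d` (p7's lever cells at `d ≤ 10`, p2's LP cells at `d ≥ 11`). -/
theorem c025_core_five_thirteen_low (M : Matroid α) [M.Finite] (d : ℕ) (hd6 : 6 ≤ d) (hd20 : d ≤ 20)
    (hR : M.eRank = ((13 : ℕ) : ℕ∞)) (hn : M.E.ncard = 13 + d)
    (hfree : ∀ e ∈ M.E, ∃ A ⊆ M.E \ {e}, e ∉ M.closure A ∧ e ∉ M.closure ((M.E \ {e}) \ A)) : RLS M 13 5 := by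
  interval_cases d
  · exact c025_core_five_thirteen_six M hR hn hfree
  · exact c025_core_five_thirteen_seven M hR hn hfree
  · exact c025_core_five_thirteen_eight M hR hn hfree
  · exact c025_core_five_thirteen_nine M hR hn hfree
  · exact c025_core_five_thirteen_ten M hR hn hfree
  · exact S2LP.c025_core_five_thirteen_eleven M hR hn hfree
  · exact S2LP.c025_core_five_thirteen_twelve M hR hn hfree
  · exact S2LP.c025_core_five_thirteen_thirteen M hR hn hfree
  · exact S2LP.c025_core_five_thirteen_fourteen M hR hn hfree
  · exact S2LP.c025_core_five_thirteen_fifteen M hR hn hfree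
  · exact S2LP.c025_core_five_thirteen_sixteen M hR hn hfree
  · exact S2LP.c025_core_five_thirteen_seventeen M hR hn hfree
  · exact S2LP.c025_core_five_thirteen_eighteen M hR hn hfree
  · exact S2LP.c025_core_five_thirteen_nineteen M hR hn hfree
  · exact S2LP.c025_core_five_thirteen_twenty M hR hn hfree

/-- The plain key cells of the `p = 13` row, `31 ≤ d ≤ 49`, dispatched by `d`. -/
theorem c025_core_five_thirteen_key (M : Matroid α) [M.Finite] (d : ℕ) (hd31 : 31 ≤ d) (hd49 : d ≤ 49)
    (hR : M.eRank = ((13 : ℕ) : ℕ∞)) (hn : M.E.ncard = 13 + d)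
    (hfree : ∀ e ∈ M.E, ∃ A ⊆ M.E \ {e}, e ∉ M.closure A ∧ e ∉ M.closure ((M.E \ {e}) \ A)) : RLS M 13 5 := by
  interval_cases d
  · exact c025_thirteen_key_31 M hR hn hfree
  · exact c025_thirteen_key_32 M hR hn hfree
  · exact c025_thirteen_key_33 M hR hn hfree
  · exact c025_thirteen_key_34 M hR hn hfree
  · exact c025_thirteen_key_35 M hR hn hfree
  · exact c025_thirteen_key_36 M hR hn hfree
  · exact c025_thirteen_key_37 M hR hn hfree
  · exact c025_thirteen_key_38 M hR hn hfree
  · exact c025_thirteen_key_39 M hR hn hfree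
  · exact c025_thirteen_key_40 M hR hn hfree
  · exact c025_thirteen_key_41 M hR hn hfree
  · exact c025_thirteen_key_42 M hR hn hfree
  · exact c025_thirteen_key_43 M hR hn hfree
  · exact c025_thirteen_key_44 M hR hn hfree
  · exact c025_thirteen_key_45 M hR hn hfree
  · exact c025_thirteen_key_46 M hR hn hfree
  · exact c025_thirteen_key_47 M hR hn hfree
  · exact c025_thirteen_key_48 M hR hn hfree
  · exact c025_thirteen_key_49 M hR hn hfree

/-- **The whole `p = 13` row for cores MODULO the ten cells `(13, 21 … 30)`**: every `e`-free core of rank `13` on `> 18` points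
satisfies `RLS M 13 5`, given the cells `(13, 21 … 30)`. -/
theorem c025_core_five_thirteen_all_of_ten_cells
    (hten : ∀ (M : Matroid α) [M.Finite] (d : ℕ), 21 ≤ d → d ≤ 30 → M.eRank = ((13 : ℕ) : ℕ∞) →
      M.E.ncard = 13 + d →
      (∀ e ∈ M.E, ∃ A ⊆ M.E \ {e}, e ∉ M.closure A ∧ e ∉ M.closure ((M.E \ {e}) \ A)) → RLS M 13 5)
    (M : Matroid α) [M.Finite] (hR : M.eRank = ((13 : ℕ) : ℕ∞)) (hbig : 13 + 5 < M.E.ncard)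
    (hfree : ∀ e ∈ M.E, ∃ A ⊆ M.E \ {e}, e ∉ M.closure A ∧ e ∉ M.closure ((M.E \ {e}) \ A)) : RLS M 13 5 := by
  have hn : M.E.ncard = 13 + (M.E.ncard - 13) := by omega
  rcases Nat.lt_or_ge M.E.ncard (13 + 21) with h | h
  · exact c025_core_five_thirteen_low M (M.E.ncard - 13) (by omega) (by omega) hR hn hfree
  rcases Nat.lt_or_ge M.E.ncard (13 + 31) with h' | h'
  · exact hten M (M.E.ncard - 13) (by omega) (by omega) hR hn hfree
  rcases Nat.lt_or_ge M.E.ncard (13 + 50) with h'' | h''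
  · exact c025_core_five_thirteen_key M (M.E.ncard - 13) (by omega) (by omega) hR hn hfree
  · exact c025_core_five_at_thirteen_big M (by omega) hfree

/-- **The whole `p = 14` row for cores**: every `e`-free core of rank `14` on `> 19` points satisfies `RLS M 14 5`
(the cells `(14, 6 … 11)`, `(14, 12 … 18)` and `c025_core_five_fourteen_ge_nineteen`). -/
theorem c025_core_five_fourteen_all (M : Matroid α) [M.Finite]
    (hR : M.eRank = ((14 : ℕ) : ℕ∞)) (hbig : 14 + 5 < M.E.ncard)
    (hfree : ∀ e ∈ M.E, ∃ A ⊆ M.E \ {e}, e ∉ M.closure A ∧ e ∉ M.closure ((M.E \ {e}) \ A)) : RLS M 14 5 := by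
  rcases Nat.lt_or_ge M.E.ncard (14 + 12) with h | h
  · have hn : M.E.ncard = 14 + (M.E.ncard - 14) := by omega
    have h6 : 6 ≤ M.E.ncard - 14 := by omega
    have h11 : M.E.ncard - 14 ≤ 11 := by omega
    generalize M.E.ncard - 14 = d at hn h6 h11
    interval_cases d
    · exact c025_core_five_fourteen_six M hR hn hfree
    · exact c025_core_five_fourteen_seven M hR hn hfree
    · exact c025_core_five_fourteen_eight M hR hn hfree
    · exact c025_core_five_fourteen_nine M hR hn hfree
    · exact c025_core_five_fourteen_ten M hR hn hfree
    · exact c025_core_five_fourteen_eleven M hR hn hfree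
  rcases Nat.lt_or_ge M.E.ncard (14 + 19) with h' | h'
  · exact c025_core_five_fourteen_xx M (M.E.ncard - 14) (by omega) (by omega) hR (by omega) hfree
  · exact c025_core_five_fourteen_ge_nineteen M hR (by omega) hfree

/-- **THEOREM C₅ AT `14` MODULO THE TEN CELLS** `(13, 21 … 30)`: `RLS M p 5` for every finite matroid and every `p ≥ 14`, given the
cells `(13, 21 … 30)` of the `e`-free core. -/
theorem c025_five_large_sharp14_of_ten_cells
    (hten : ∀ (M : Matroid α) [M.Finite] (d : ℕ), 21 ≤ d → d ≤ 30 → M.eRank = ((13 : ℕ) : ℕ∞) →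
      M.E.ncard = 13 + d →
      (∀ e ∈ M.E, ∃ A ⊆ M.E \ {e}, e ∉ M.closure A ∧ e ∉ M.closure ((M.E \ {e}) \ A)) → RLS M 13 5)
    (M : Matroid α) [M.Finite] (p : ℕ) (hp : 14 ≤ p) : RLS M p 5 := by
  refine S2.rls_five_of_four_of_core 13 (by omega) (fun M _ p hp => S1.c025_four_eleven M p (by omega)) ?_ M p hp
  intro M _ p hP hR hbig hfree
  rcases Nat.lt_or_ge p 14 with h13 | h14
  · have hp' : p = 13 := by omega
    subst hp'
    exact c025_core_five_thirteen_all_of_ten_cells hten M hR hbig hfree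
  rcases Nat.lt_or_ge p 15 with h14' | h15
  · have hp' : p = 14 := by omega
    subst hp'
    exact c025_core_five_fourteen_all M hR hbig hfree
  · exact c025_five_large_sharp15 M p h15

end ThmN

end PercRepro
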